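import Mathlib
import Summits.ResolutionOfSingularities.ResolutionOfSingularities.Theses.WeightedInvariant
import Literature.AlgebraicGeometry.Resolution.CobordantGame
import Literature.AlgebraicGeometry.Resolution.CobordantChartCoefficients
import Literature.AlgebraicGeometry.Resolution.CobordantTupleGame
import Literature.AlgebraicGeometry.Resolution.PlaneGermBlowup
import Literature.AlgebraicGeometry.Resolution.PlaneGermNonNCCountRadical
import Summits.ResolutionOfSingularities.ResolutionOfSingularities.Theorems.WeightedInvariantGlobalizeLocalDropCanonize
import Summits.ResolutionOfSingularities.ResolutionOfSingularities.Theorems.WeightedInvariantGlobalizeLocalDropRegularGerms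
import Summits.ResolutionOfSingularities.ResolutionOfSingularities.Theorems.WeightedInvariantLocalWeightedDropPurePowerWon
import Summits.ResolutionOfSingularities.ResolutionOfSingularities.Theorems.WeightedInvariantLocalWeightedDropConeDichotomyAux
import Summits.ResolutionOfSingularities.ResolutionOfSingularities.Theorems.WeightedInvariantLocalWeightedDropConeDichotomy
import Summits.ResolutionOfSingularities.ResolutionOfSingularities.Theorems.WeightedInvariantLocalWeightedDropPlaneWon
import Summits.ResolutionOfSingularities.ResolutionOfSingularities.Theorems.WeightedInvariantLocalWeightedDropTangentConeCut
import Summits.ResolutionOfSingularities.ResolutionOfSingularities.Theorems.WeightedInvariantLocalWeightedDropPlaneNonNCCount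
import Summits.ResolutionOfSingularities.ResolutionOfSingularities.Theorems.WeightedInvariantLocalWeightedDropTschirnhausForm
import Summits.ResolutionOfSingularities.ResolutionOfSingularities.Theorems.WeightedInvariantLocalWeightedDropMultiplicityLift
import Summits.ResolutionOfSingularities.ResolutionOfSingularities.Theorems.WeightedInvariantLocalWeightedDropPlaneCountRadical
import Summits.ResolutionOfSingularities.ResolutionOfSingularities.Theorems.WeightedInvariantLocalWeightedDropPlaneMonomialPhase
import Summits.ResolutionOfSingularities.ResolutionOfSingularities.Theorems.WeightedInvariantLocalWeightedDropTupleDropPlane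

/-!
# `LocalWeightedDrop`: the tame-multiplicity lift — the crux from TWO cores, and the tame surface germs

Route `ResolutionOfSingularities/WeightedInvariant`, crux `LocalWeightedDrop` (stmt-ResolutionOfSingularities-8899), line
`hasse-ridge-face-selection`, fifth lead (skeleton v16/v17).  The sorry-free GLUE of the TAME-MULTIPLICITY LIFT as importable
theorems.  Inputs landed by this lead's waves: `stub_tschirnhausForm` (maximal-contact / Tschirnhaus form for a multiplicity
prime to `p`), `stub_multiplicityLift` (all dimensions: the prepared germ `U·y^{e+2} + Σ a_j y^j` is won as soon as the
coefficient TUPLE GAME one dimension down is won and the singular germs of smaller order are won), and the plane tuple game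
`stub_tupleDropPlane ∘ (stub_planeCountRadical, stub_planeMonomialPhase)` (order reduction of marked coefficient tuples in the
plane: strong embedded resolution of plane curves in radical-monotone count form + the monomial phase).

* `TameLift.preparedWon_of_drop` — in ANY dimension `m + 1`: the tuple game `TupleGame.Drop k m e` and the singular germs of
  order `< e + 2` give every singular germ of order `e + 2` with `p ∤ e + 2` (Tschirnhaus form ∘ lift; zero tuple = pure power).
* `TameLift.tameSurfaceWon` — UNCONDITIONAL for `m + 1 = 3`: surface germs of multiplicity prime to `p` are won given the
  surface germs of smaller order.
* `TameLift.coneStartsWon_local`, `…fixedDimStartsWon`, `…higherStartsWon`, `localWeightedDrop_of_twoCores`,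
  `stub_localWeightedDrop_iff_twoCores` — the crux ⟺ CORE W (wild: `p ∣ ord f`, square tangent quadric, cylindrical tangent
  cone for `ord f ≥ 3`, `N ≥ 3`) ∧ CORE T (tame: `p ∤ ord f`, the same cone shapes, `N ≥ 4`), the cores spelled exactly as the
  registered stubs `stub_wildCylindricalStartsWon`, `stub_tameCylindricalHigherStartsWon` of skeleton v16.
* Unconditional by-products: `TameLift.surfaceStartsWon_of_wildSurfaceCore` (ALL singular surface germs are won as soon as the
  wild surface core is) and `TameLift.surfaceGermWon_of_order_lt_char` (every singular surface germ of order `< p` is won).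

Deliberately NOT here: any claim about the two cores (open mathematics: wild surface multiplicities; dimension `≥ 4`).
-/

set_option linter.dupNamespace false -- mandated namespace of this single-conjunct summit

namespace Summit.ResolutionOfSingularities.ResolutionOfSingularities.Theorems

open Literature.AlgebraicGeometry.Resolution

namespace TameLift

open Literature.AlgebraicGeometry.Resolution.CobordantGame

variable {k : Type} [Field k]

/-- The diagonal degree-`2` coefficient of the square of a linear form: `ℓ_i²`. -/
theorem coeff_sq_linear_diag {N : ℕ} (ℓ : Fin N → k) (i : Fin N) :
    MvPowerSeries.coeff (Finsupp.single i 1 + Finsupp.single i 1)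
      ((∑ l, MvPowerSeries.C (ℓ l) * MvPowerSeries.X l : MvPowerSeries (Fin N) k) ^ 2) = ℓ i * ℓ i := by
  rw [ConeDichotomy.sq_linear_eq_quadP, ConeDichotomy.coeff_pair_quadP, if_pos rfl, Matrix.of_apply]

/-- A singular germ whose tangent quadric is a NON-ZERO square has order `2`. -/
theorem order_eq_two_of_sq {N : ℕ} {f : MvPowerSeries (Fin N) k} (hf : IsSingular k f) {ℓ : Fin N → k}
    (hℓ : ∀ i j : Fin N, MvPowerSeries.coeff (Finsupp.single i 1 + Finsupp.single j 1) f =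
      MvPowerSeries.coeff (Finsupp.single i 1 + Finsupp.single j 1)
        ((∑ l, MvPowerSeries.C (ℓ l) * MvPowerSeries.X l) ^ 2))
    {i : Fin N} (hi : ℓ i ≠ 0) {d : ℕ} (hd : f.order = d) : d = 2 := by
  have hc : MvPowerSeries.coeff (Finsupp.single i 1 + Finsupp.single i 1) f ≠ 0 := by
    rw [hℓ, coeff_sq_linear_diag]
    exact mul_ne_zero hi hi
  have hle : f.order ≤ 2 := by
    have h := MvPowerSeries.order_le hc
    have hdeg : (Finsupp.single i 1 + Finsupp.single i 1 : Fin N →₀ ℕ).degree = 2 := by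
      rw [map_add, Finsupp.degree_single]
    rw [hdeg] at h
    exact_mod_cast h
  have hge : 2 ≤ f.order := (FormalCoordChange.two_le_order_iff f).mpr hf.2
  rw [hd] at hle hge
  have h1 : d ≤ 2 := by exact_mod_cast hle
  have h2 : 2 ≤ d := by exact_mod_cast hge
  omega

/-- TAME MULTIPLICITIES REDUCE TO THE TUPLE GAME ONE DIMENSION DOWN (every dimension `m + 1`): if the coefficient-tuple game
`TupleGame.Drop k m e` is won and every singular germ in `m + 1` variables of order `< e + 2` is won, then every singular germ of
order `e + 2` with `p ∤ e + 2` is won — Tschirnhaus form (`stub_tschirnhausForm`), zero tuple ⇒ pure power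
(`stub_purePowerWon`), otherwise the multiplicity lift (`stub_multiplicityLift`). -/
theorem preparedWon_of_drop (p : ℕ) (hp : p.Prime) (k : Type) [Field k] [CharP k p] [IsAlgClosed k] (m e : ℕ)
    (hdrop : TupleGame.Drop k m e)
    (hlow : ∀ G : MvPowerSeries (Fin (m + 1)) k, IsSingular k G → G.order < ((e + 2 : ℕ) : ℕ∞) → Won k (m + 1) G)
    (f : MvPowerSeries (Fin (m + 1)) k) (hf : IsSingular k f) (hfd : f.order = ((e + 2 : ℕ) : ℕ∞))
    (hpd : ¬ p ∣ (e + 2)) : Won k (m + 1) f := by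
  obtain ⟨θ, U, a, hθ0, hθdet, hU, hBad, hθf⟩ := stub_tschirnhausForm p hp k m e f hf hfd hpd
  rw [← won_subst_iff hθ0 hθdet, hθf]
  by_cases ha : a = 0
  · subst ha
    have hgerm : TupleGame.germ U (0 : Fin (e + 1) → MvPowerSeries (Fin m) k) =
        U * MvPowerSeries.X (Fin.last m) ^ (e + 2) := by
      unfold TupleGame.germ
      simp
    rw [hgerm]
    exact (stub_purePowerWon k m U (MvPowerSeries.X (Fin.last m)) (e + 2) hU (MvPowerSeries.constantCoeff_X _)
      ⟨Fin.last m, by rw [MvPowerSeries.coeff_X, if_pos rfl]; exact one_ne_zero⟩).won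
  · have hcast : ((e + 2 : ℕ) : k) ≠ 0 := fun h => hpd ((CharP.cast_eq_zero_iff k p _).mp h)
    exact stub_multiplicityLift p hp k m e hcast hdrop hlow U a hU ha hBad

/-- THE PLANE TUPLE GAME IS WON (unconditional): `TupleGame.Drop k 2 e` for every field `k` and every `e`. -/
theorem tupleDropPlane (k : Type) [Field k] (e : ℕ) : TupleGame.Drop k 2 e :=
  stub_tupleDropPlane k (stub_planeCountRadical k) (stub_planeMonomialPhase k) e
/-- TAME SURFACE GERMS ARE WON (unconditional given the lower order): over an algebraically closed field of characteristic `p`,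
a singular surface germ `f ∈ k[[x,y,z]]` of order `e + 2` with `p ∤ e + 2` is won as soon as every singular surface germ of
smaller order is won. -/
theorem tameSurfaceWon (p : ℕ) (hp : p.Prime) (k : Type) [Field k] [CharP k p] [IsAlgClosed k] (e : ℕ)
    (f : MvPowerSeries (Fin 3) k) (hf : IsSingular k f) (hfd : f.order = ((e + 2 : ℕ) : ℕ∞)) (hpd : ¬ p ∣ (e + 2))
    (hord : ∀ g : MvPowerSeries (Fin 3) k, IsSingular k g → g.order < f.order → Won k 3 g) : Won k 3 f :=
  preparedWon_of_drop p hp k 2 e (tupleDropPlane k e) (fun G hG hlt => hord G hG (hfd ▸ hlt)) f hf hfd hpd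

/-- THE TANGENT-CONE SPLIT with LOCAL core obligations: a singular `f` in `n + 3` variables with square tangent quadric, given
the singular germs of smaller order, is won provided (W) it is won if `p ∣ ord f` and (T) it is won if `n ≥ 1` and `p ∤ ord f` —
both only under the cone shapes of CORE W / CORE T; everything else is discharged here (`tameDoublePointSurfaceWon`,
`apexFreeStartsWon`, `tameSurfaceWon`). -/
theorem coneStartsWon_local (p : ℕ) (hp : p.Prime) (k : Type) [Field k] [CharP k p] [IsAlgClosed k]
    (n : ℕ) (f : MvPowerSeries (Fin (n + 3)) k) (hf : IsSingular k f)
    (hord : ∀ g : MvPowerSeries (Fin (n + 3)) k, IsSingular k g → g.order < f.order → Won k (n + 3) g)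
    (ℓ : Fin (n + 3) → k) (hℓ : ∀ i j : Fin (n + 3),
      MvPowerSeries.coeff (Finsupp.single i 1 + Finsupp.single j 1) f =
        MvPowerSeries.coeff (Finsupp.single i 1 + Finsupp.single j 1)
          ((∑ l, MvPowerSeries.C (ℓ l) * MvPowerSeries.X l) ^ 2))
    (d : ℕ) (hd : f.order = d)
    (hW : p ∣ d → (2 < d → ∃ c : Fin (n + 3) → k, c ≠ 0 ∧ ∀ v : Fin (n + 3) → k,
      CobordantChart.initEval (fun _ : Fin (n + 3) => 1) (v + c) d f =
        CobordantChart.initEval (fun _ : Fin (n + 3) => 1) v d f) → Won k (n + 3) f)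
    (hT : 0 < n → ¬ p ∣ d → (2 < d → ∃ c : Fin (n + 3) → k, c ≠ 0 ∧ ∀ v : Fin (n + 3) → k,
      CobordantChart.initEval (fun _ : Fin (n + 3) => 1) (v + c) d f =
        CobordantChart.initEval (fun _ : Fin (n + 3) => 1) v d f) → Won k (n + 3) f) :
    Won k (n + 3) f := by
  have hd2 : 2 ≤ d := by
    have h := (FormalCoordChange.two_le_order_iff f).mpr hf.2
    rw [hd] at h
    exact_mod_cast h
  by_cases hℓ0 : ∃ i, ℓ i ≠ 0
  · -- DOUBLE POINT with square tangent quadric `ℓ² ≠ 0`: `d = 2`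
    obtain ⟨i, hi⟩ := hℓ0
    have hd' : d = 2 := order_eq_two_of_sq hf hℓ hi hd
    by_cases hp2 : p = 2
    · subst hp2
      exact hW (by rw [hd']) (fun h => absurd h (by omega))
    · cases n with
      | zero =>
        exact TangentConeCut.tameDoublePointSurfaceWon (fun k _ _ => planeGermNonNCCount k) p hp hp2 k f hf
          ⟨ℓ, ⟨i, hi⟩, hℓ⟩
      | succ n =>
        exact hT (Nat.succ_pos n) (fun h => hp2 ((Nat.prime_dvd_prime_iff_eq hp Nat.prime_two).mp (hd' ▸ h)))
          (fun h => absurd h (by omega))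
  · -- tangent quadric ZERO: read the tangent cone of degree `d`
    by_cases hapex : ∃ c : Fin (n + 3) → k, c ≠ 0 ∧ ∀ v : Fin (n + 3) → k,
        CobordantChart.initEval (fun _ : Fin (n + 3) => 1) (v + c) d f =
          CobordantChart.initEval (fun _ : Fin (n + 3) => 1) v d f
    swap
    · push Not at hapex
      exact TangentConeCut.apexFreeStartsWon p hp k (Nat.succ_pos _) f d hd hord hapex
    by_cases hpd : p ∣ d
    · exact hW hpd (fun _ => hapex)
    · cases n with
      | zero =>
        obtain ⟨e, rfl⟩ : ∃ e, d = e + 2 := ⟨d - 2, by omega⟩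
        exact tameSurfaceWon p hp k e f hf hd hpd hord
      | succ n => exact hT (Nat.succ_pos n) hpd (fun _ => hapex)

/-- EVERY SINGULAR SURFACE GERM OF ORDER `< p` IS WON (unconditional): by strong induction on the order, the wild obligation of
`coneStartsWon_local` is contradictory (`p ∣ d`, `2 ≤ d < p`) and the higher-dimensional one is vacuous. -/
theorem surfaceGermWon_of_order_lt_char (p : ℕ) (hp : p.Prime) (k : Type) [Field k] [CharP k p] [IsAlgClosed k]
    (f : MvPowerSeries (Fin 3) k) (hf : IsSingular k f) (hfp : f.order < (p : ℕ∞)) : Won k 3 f := by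
  suffices key : ∀ (d : ℕ) (f : MvPowerSeries (Fin 3) k), f.order = d → d < p → IsSingular k f → Won k 3 f by
    obtain ⟨d, hd⟩ : ∃ d : ℕ, f.order = d :=
      ⟨f.order.toNat, ((MvPowerSeries.ne_zero_iff_order_finite).mp hf.1).symm⟩
    exact key d f hd (by rw [hd] at hfp; exact_mod_cast hfp) hf
  intro d
  induction d using Nat.strong_induction_on with
  | _ d IHd =>
    intro f hfd hdp hf
    have hord : ∀ g : MvPowerSeries (Fin 3) k, IsSingular k g → g.order < f.order → Won k 3 g := by
      intro g hg hlt
      have hgo : (g.order.toNat : ℕ∞) = g.order := (MvPowerSeries.ne_zero_iff_order_finite).mp hg.1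
      have hlt' : g.order.toNat < d := by
        have : (g.order.toNat : ℕ∞) < (d : ℕ∞) := by rw [hgo, ← hfd]; exact hlt
        exact_mod_cast this
      exact IHd g.order.toNat hlt' g hgo.symm (lt_trans hlt' hdp) hg
    rcases stub_coneDichotomy k 1 f hf with hhyp | ⟨ℓ, hℓ⟩
    · exact TangentConeCut.hyperbolicStartsWon (fun g hg => PlaneWon.lineWon g hg) f hf hhyp
    · refine coneStartsWon_local p hp k 0 f hf hord ℓ hℓ d hfd (fun hpd _ => ?_) (fun h _ _ => absurd h (lt_irrefl 0))
      have hd2 : 2 ≤ d := by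
        have h := (FormalCoordChange.two_le_order_iff f).mpr hf.2
        rw [hfd] at h
        exact_mod_cast h
      exact absurd (Nat.le_of_dvd (by omega) hpd) (by omega)

section Cores
/-! ### The two residual cores (verbatim registered stub signatures of skeleton v16) -/

variable (hW : ∀ (p : ℕ), p.Prime → ∀ (k : Type) [Field k] [CharP k p] [IsAlgClosed k]
    (n : ℕ), (∀ m : ℕ, m < n + 3 → ∀ g : MvPowerSeries (Fin m) k,
      CobordantGame.IsSingular k g → CobordantGame.Won k m g) →
    ∀ (f : MvPowerSeries (Fin (n + 3)) k), CobordantGame.IsSingular k f →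
    (∀ g : MvPowerSeries (Fin (n + 3)) k, CobordantGame.IsSingular k g → g.order < f.order →
      CobordantGame.Won k (n + 3) g) →
    ∀ (d : ℕ), f.order = d → p ∣ d →
    (∃ ℓ : Fin (n + 3) → k, ∀ i j : Fin (n + 3),
      MvPowerSeries.coeff (Finsupp.single i 1 + Finsupp.single j 1) f =
        MvPowerSeries.coeff (Finsupp.single i 1 + Finsupp.single j 1)
          ((∑ l, MvPowerSeries.C (ℓ l) * MvPowerSeries.X l) ^ 2)) →
    (2 < d → ∃ c : Fin (n + 3) → k, c ≠ 0 ∧ ∀ v : Fin (n + 3) → k,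
      CobordantChart.initEval (fun _ : Fin (n + 3) => 1) (v + c) d f =
        CobordantChart.initEval (fun _ : Fin (n + 3) => 1) v d f) →
    CobordantGame.Won k (n + 3) f)
variable (hT : ∀ (p : ℕ), p.Prime → ∀ (k : Type) [Field k] [CharP k p] [IsAlgClosed k]
    (n : ℕ), (∀ m : ℕ, m < n + 4 → ∀ g : MvPowerSeries (Fin m) k,
      CobordantGame.IsSingular k g → CobordantGame.Won k m g) →
    ∀ (f : MvPowerSeries (Fin (n + 4)) k), CobordantGame.IsSingular k f →
    (∀ g : MvPowerSeries (Fin (n + 4)) k, CobordantGame.IsSingular k g → g.order < f.order →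
      CobordantGame.Won k (n + 4) g) →
    ∀ (d : ℕ), f.order = d → ¬ p ∣ d →
    (∃ ℓ : Fin (n + 4) → k, ∀ i j : Fin (n + 4),
      MvPowerSeries.coeff (Finsupp.single i 1 + Finsupp.single j 1) f =
        MvPowerSeries.coeff (Finsupp.single i 1 + Finsupp.single j 1)
          ((∑ l, MvPowerSeries.C (ℓ l) * MvPowerSeries.X l) ^ 2)) →
    (2 < d → ∃ c : Fin (n + 4) → k, c ≠ 0 ∧ ∀ v : Fin (n + 4) → k,
      CobordantChart.initEval (fun _ : Fin (n + 4) => 1) (v + c) d f =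
        CobordantChart.initEval (fun _ : Fin (n + 4) => 1) v d f) →
    CobordantGame.Won k (n + 4) f)

include hW hT in
/-- ALL SINGULAR GERMS IN DIMENSION `n + 3` ARE WON given the lower dimensions, modulo the two cores: inner strong induction
on the order; hyperbolic quadric ⇒ `TangentConeCut.hyperbolicStartsWon`, square ⇒ `coneStartsWon_local` fed with the cores. -/
theorem fixedDimStartsWon (p : ℕ) (hp : p.Prime) (k : Type) [Field k] [CharP k p] [IsAlgClosed k]
    (n : ℕ) (IH : ∀ m : ℕ, m < n + 3 → ∀ g : MvPowerSeries (Fin m) k, IsSingular k g → Won k m g) :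
    ∀ (f : MvPowerSeries (Fin (n + 3)) k), IsSingular k f → Won k (n + 3) f := by
  suffices key : ∀ (d : ℕ) (f : MvPowerSeries (Fin (n + 3)) k), f.order = d → IsSingular k f → Won k (n + 3) f by
    intro f hf
    exact key _ f ((MvPowerSeries.ne_zero_iff_order_finite).mp hf.1).symm hf
  intro d
  induction d using Nat.strong_induction_on with
  | _ d IHd =>
    intro f hfd hf
    have hord : ∀ g : MvPowerSeries (Fin (n + 3)) k, IsSingular k g → g.order < f.order → Won k (n + 3) g := by
      intro g hg hlt
      have hgo : (g.order.toNat : ℕ∞) = g.order := (MvPowerSeries.ne_zero_iff_order_finite).mp hg.1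
      refine IHd g.order.toNat ?_ g hgo.symm hg
      have : (g.order.toNat : ℕ∞) < (d : ℕ∞) := by rw [hgo, ← hfd]; exact hlt
      exact_mod_cast this
    rcases stub_coneDichotomy k (n + 1) f hf with hhyp | ⟨ℓ, hℓ⟩
    · exact TangentConeCut.hyperbolicStartsWon (fun g hg => IH (n + 1) (by omega) g hg) f hf hhyp
    · refine coneStartsWon_local p hp k n f hf hord ℓ hℓ d hfd
        (fun hpd hcyl => hW p hp k n IH f hf hord d hfd hpd ⟨ℓ, hℓ⟩ hcyl) (fun hn hpd hcyl => ?_)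
      cases n with
      | zero => exact absurd hn (lt_irrefl 0)
      | succ n => exact hT p hp k n IH f hf hord d hfd hpd ⟨ℓ, hℓ⟩ hcyl

include hW hT in
/-- EVERY SINGULAR GERM IS WON modulo the two cores: strong induction on `N`; `N ≤ 2` landed (`PlaneWon`). -/
theorem higherStartsWon (p : ℕ) (hp : p.Prime) (k : Type) [Field k] [CharP k p] [IsAlgClosed k] :
    ∀ (N : ℕ) (f : MvPowerSeries (Fin N) k), IsSingular k f → Won k N f := by
  intro N
  induction N using Nat.strong_induction_on with
  | _ N IH =>
    intro f hf
    match N, f, hf, IH with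
    | 0, f, hf, _ => exact absurd hf (PlaneWon.not_isSingular_fin_zero f)
    | 1, f, hf, _ => exact PlaneWon.lineWon f hf
    | 2, f, hf, _ => exact stub_planeWon k f hf
    | n + 3, f, hf, IH => exact fixedDimStartsWon hW hT p hp k n (fun m hm g hg => IH m hm g hg) f hf

end Cores

/-- ALL SINGULAR SURFACE GERMS ARE WON AS SOON AS THE WILD SURFACE CORE IS (unconditional implication, `N = 3` only): the
higher-dimensional core is never invoked in three variables. -/
theorem surfaceStartsWon_of_wildSurfaceCore (p : ℕ) (hp : p.Prime) (k : Type) [Field k] [CharP k p] [IsAlgClosed k]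
    (hW3 : ∀ (f : MvPowerSeries (Fin 3) k), IsSingular k f →
      (∀ g : MvPowerSeries (Fin 3) k, IsSingular k g → g.order < f.order → Won k 3 g) →
      ∀ (d : ℕ), f.order = d → p ∣ d →
      (∃ ℓ : Fin 3 → k, ∀ i j : Fin 3,
        MvPowerSeries.coeff (Finsupp.single i 1 + Finsupp.single j 1) f =
          MvPowerSeries.coeff (Finsupp.single i 1 + Finsupp.single j 1)
            ((∑ l, MvPowerSeries.C (ℓ l) * MvPowerSeries.X l) ^ 2)) →
      (2 < d → ∃ c : Fin 3 → k, c ≠ 0 ∧ ∀ v : Fin 3 → k,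
        CobordantChart.initEval (fun _ : Fin 3 => 1) (v + c) d f =
          CobordantChart.initEval (fun _ : Fin 3 => 1) v d f) →
      Won k 3 f) :
    ∀ (f : MvPowerSeries (Fin 3) k), IsSingular k f → Won k 3 f := by
  suffices key : ∀ (d : ℕ) (f : MvPowerSeries (Fin 3) k), f.order = d → IsSingular k f → Won k 3 f by
    intro f hf
    exact key _ f ((MvPowerSeries.ne_zero_iff_order_finite).mp hf.1).symm hf
  intro d
  induction d using Nat.strong_induction_on with
  | _ d IHd =>
    intro f hfd hf
    have hord : ∀ g : MvPowerSeries (Fin 3) k, IsSingular k g → g.order < f.order → Won k 3 g := by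
      intro g hg hlt
      have hgo : (g.order.toNat : ℕ∞) = g.order := (MvPowerSeries.ne_zero_iff_order_finite).mp hg.1
      refine IHd g.order.toNat ?_ g hgo.symm hg
      have : (g.order.toNat : ℕ∞) < (d : ℕ∞) := by rw [hgo, ← hfd]; exact hlt
      exact_mod_cast this
    rcases stub_coneDichotomy k 1 f hf with hhyp | ⟨ℓ, hℓ⟩
    · exact TangentConeCut.hyperbolicStartsWon (fun g hg => PlaneWon.lineWon g hg) f hf hhyp
    · exact coneStartsWon_local p hp k 0 f hf hord ℓ hℓ d hfd
        (fun hpd hcyl => hW3 f hf hord d hfd hpd ⟨ℓ, hℓ⟩ hcyl) (fun hn _ _ => absurd hn (lt_irrefl 0))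

end TameLift

/-- THE CRUX FROM THE TWO RESIDUAL CORES (the planner's glue for a promoted split): CORE W (wild multiplicities: `p ∣ ord f`,
tangent quadric a square, cylindrical tangent cone when `ord f ≥ 3`, `N ≥ 3`) → CORE T (tame: `p ∤ ord f`, same shapes,
`N ≥ 4`) → `LocalWeightedDrop`, the cores spelled exactly as the registered stubs `stub_wildCylindricalStartsWon`,
`stub_tameCylindricalHigherStartsWon`. -/
theorem localWeightedDrop_of_twoCores
    (hW : ∀ (p : ℕ), p.Prime → ∀ (k : Type) [Field k] [CharP k p] [IsAlgClosed k]
      (n : ℕ), (∀ m : ℕ, m < n + 3 → ∀ g : MvPowerSeries (Fin m) k,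
        CobordantGame.IsSingular k g → CobordantGame.Won k m g) →
      ∀ (f : MvPowerSeries (Fin (n + 3)) k), CobordantGame.IsSingular k f →
      (∀ g : MvPowerSeries (Fin (n + 3)) k, CobordantGame.IsSingular k g → g.order < f.order →
        CobordantGame.Won k (n + 3) g) →
      ∀ (d : ℕ), f.order = d → p ∣ d →
      (∃ ℓ : Fin (n + 3) → k, ∀ i j : Fin (n + 3),
        MvPowerSeries.coeff (Finsupp.single i 1 + Finsupp.single j 1) f =
          MvPowerSeries.coeff (Finsupp.single i 1 + Finsupp.single j 1)
            ((∑ l, MvPowerSeries.C (ℓ l) * MvPowerSeries.X l) ^ 2)) →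
      (2 < d → ∃ c : Fin (n + 3) → k, c ≠ 0 ∧ ∀ v : Fin (n + 3) → k,
        CobordantChart.initEval (fun _ : Fin (n + 3) => 1) (v + c) d f =
          CobordantChart.initEval (fun _ : Fin (n + 3) => 1) v d f) →
      CobordantGame.Won k (n + 3) f)
    (hT : ∀ (p : ℕ), p.Prime → ∀ (k : Type) [Field k] [CharP k p] [IsAlgClosed k]
      (n : ℕ), (∀ m : ℕ, m < n + 4 → ∀ g : MvPowerSeries (Fin m) k,
        CobordantGame.IsSingular k g → CobordantGame.Won k m g) →
      ∀ (f : MvPowerSeries (Fin (n + 4)) k), CobordantGame.IsSingular k f →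
      (∀ g : MvPowerSeries (Fin (n + 4)) k, CobordantGame.IsSingular k g → g.order < f.order →
        CobordantGame.Won k (n + 4) g) →
      ∀ (d : ℕ), f.order = d → ¬ p ∣ d →
      (∃ ℓ : Fin (n + 4) → k, ∀ i j : Fin (n + 4),
        MvPowerSeries.coeff (Finsupp.single i 1 + Finsupp.single j 1) f =
          MvPowerSeries.coeff (Finsupp.single i 1 + Finsupp.single j 1)
            ((∑ l, MvPowerSeries.C (ℓ l) * MvPowerSeries.X l) ^ 2)) →
      (2 < d → ∃ c : Fin (n + 4) → k, c ≠ 0 ∧ ∀ v : Fin (n + 4) → k,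
        CobordantChart.initEval (fun _ : Fin (n + 4) => 1) (v + c) d f =
          CobordantChart.initEval (fun _ : Fin (n + 4) => 1) v d f) →
      CobordantGame.Won k (n + 4) f) :
    Summit.ResolutionOfSingularities.ResolutionOfSingularities.Theses.WeightedInvariant.LocalWeightedDrop := by
  rw [localWeightedDrop_iff_allWon]
  intro p hp k _ _ _ n f hf
  exact TameLift.higherStartsWon hW hT p hp k n f hf

/-- THE CRUX `LocalWeightedDrop` ⟺ CORE W ∧ CORE T (wild multiplicities in `≥ 3` variables; tame cylindrical cones in `≥ 4`
variables): after the tame-multiplicity lift the whole surface case (`N = 3`) of the local weighted resolution game reduces to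
its wild multiplicities, and the two cores are exactly what is open.  `⇐` is `localWeightedDrop_of_twoCores`; `⇒` is immediate
from `localWeightedDrop_iff_allWon`.  (Registered stub `stub_localWeightedDrop_iff_twoCores` of skeleton v17.) -/
theorem stub_localWeightedDrop_iff_twoCores :
    Summit.ResolutionOfSingularities.ResolutionOfSingularities.Theses.WeightedInvariant.LocalWeightedDrop ↔
    ((∀ (p : ℕ), p.Prime → ∀ (k : Type) [Field k] [CharP k p] [IsAlgClosed k]
      (n : ℕ), (∀ m : ℕ, m < n + 3 → ∀ g : MvPowerSeries (Fin m) k,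
        CobordantGame.IsSingular k g → CobordantGame.Won k m g) →
      ∀ (f : MvPowerSeries (Fin (n + 3)) k), CobordantGame.IsSingular k f →
      (∀ g : MvPowerSeries (Fin (n + 3)) k, CobordantGame.IsSingular k g → g.order < f.order →
        CobordantGame.Won k (n + 3) g) →
      ∀ (d : ℕ), f.order = d → p ∣ d →
      (∃ ℓ : Fin (n + 3) → k, ∀ i j : Fin (n + 3),
        MvPowerSeries.coeff (Finsupp.single i 1 + Finsupp.single j 1) f =
          MvPowerSeries.coeff (Finsupp.single i 1 + Finsupp.single j 1)
            ((∑ l, MvPowerSeries.C (ℓ l) * MvPowerSeries.X l) ^ 2)) →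
      (2 < d → ∃ c : Fin (n + 3) → k, c ≠ 0 ∧ ∀ v : Fin (n + 3) → k,
        CobordantChart.initEval (fun _ : Fin (n + 3) => 1) (v + c) d f =
          CobordantChart.initEval (fun _ : Fin (n + 3) => 1) v d f) →
      CobordantGame.Won k (n + 3) f) ∧
    (∀ (p : ℕ), p.Prime → ∀ (k : Type) [Field k] [CharP k p] [IsAlgClosed k]
      (n : ℕ), (∀ m : ℕ, m < n + 4 → ∀ g : MvPowerSeries (Fin m) k,
        CobordantGame.IsSingular k g → CobordantGame.Won k m g) →
      ∀ (f : MvPowerSeries (Fin (n + 4)) k), CobordantGame.IsSingular k f →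
      (∀ g : MvPowerSeries (Fin (n + 4)) k, CobordantGame.IsSingular k g → g.order < f.order →
        CobordantGame.Won k (n + 4) g) →
      ∀ (d : ℕ), f.order = d → ¬ p ∣ d →
      (∃ ℓ : Fin (n + 4) → k, ∀ i j : Fin (n + 4),
        MvPowerSeries.coeff (Finsupp.single i 1 + Finsupp.single j 1) f =
          MvPowerSeries.coeff (Finsupp.single i 1 + Finsupp.single j 1)
            ((∑ l, MvPowerSeries.C (ℓ l) * MvPowerSeries.X l) ^ 2)) →
      (2 < d → ∃ c : Fin (n + 4) → k, c ≠ 0 ∧ ∀ v : Fin (n + 4) → k,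
        CobordantChart.initEval (fun _ : Fin (n + 4) => 1) (v + c) d f =
          CobordantChart.initEval (fun _ : Fin (n + 4) => 1) v d f) →
      CobordantGame.Won k (n + 4) f)) := by
  constructor
  · intro h
    have hA := (localWeightedDrop_iff_allWon).mp h
    refine ⟨?_, ?_⟩
    · intro p hp k _ _ _ n _ f hf _ _ _ _ _ _
      exact hA p hp k (n + 3) f hf
    · intro p hp k _ _ _ n _ f hf _ _ _ _ _ _
      exact hA p hp k (n + 4) f hf
  · rintro ⟨hW, hT⟩
    exact localWeightedDrop_of_twoCores hW hT

end Summit.ResolutionOfSingularities.ResolutionOfSingularities.Theorems
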